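import Summits.AtomisticToContinuum.FouriersLaw.Theses.AffineAnchorRing

/-!
# Birth skeleton for the piece `AnchorNoLateExcess` of the AnchorKuboFourier decomposition (crux stmt-AtomisticToContinuum-12455)

Three named stubs — (I) integrability of `c_N` at fixed `N`, (S) the N-uniform static bound `|c_N(t)| ≤ A·N`, (U⁺) uniform smallness of the
hard-cut late POSITIVE mass `∫_τ^∞ (c_N)₊ ≤ ηN` — and the PROVED composition `AnchorNoLateExcess_of` via the generic soft-cut lemma
`softCut_integral_le` (`∫₀^∞(1−e^{−εt})f ≤ ετ²B + M`). (I), (S) are theorem-grade; (U⁺) carries the content. Sorries only in the stubs.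
-/

namespace Summit.AtomisticToContinuum.FouriersLaw.Cruxes.AnchorKuboFourier.RegimeSplit.AnchorNoLateExcessBirth

open MeasureTheory Filter Set Topology

/-! ## Generic real analysis: a soft-cut late mass is controlled by an early static bound and the hard-cut late positive mass -/

/-- `0 ≤ 1 - e^{-x} ≤ x` for `x ≥ 0`. [folklore] -/
theorem one_sub_exp_neg_bounds {x : ℝ} (hx : 0 ≤ x) :
    0 ≤ 1 - Real.exp (-x) ∧ 1 - Real.exp (-x) ≤ x := by
  constructor
  · have : Real.exp (-x) ≤ 1 := Real.exp_le_one_iff.2 (by linarith)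
    linarith
  · have := Real.add_one_le_exp (-x)
    linarith

/-- **Soft-cut bound.** If `f` is integrable on `(0,∞)`, `|f| ≤ B` on `(0,∞)` and the positive part of `f` has mass `≤ M`
beyond `τ > 0`, then for `ε > 0`: `∫₀^∞ (1 − e^{−εt}) f(t) dt ≤ ε·τ²·B + M`. [folklore] -/
theorem softCut_integral_le (f : ℝ → ℝ) {B M ε τ : ℝ} (hε : 0 < ε) (hτ : 0 < τ)
    (hf : IntegrableOn f (Ioi 0)) (hB : ∀ t : ℝ, 0 < t → |f t| ≤ B)
    (hM : (∫ t in Ioi τ, max (f t) 0) ≤ M) :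
    (∫ t in Ioi (0:ℝ), (1 - Real.exp (-(ε * t))) * f t) ≤ ε * τ ^ 2 * B + M := by
  have hB0 : 0 ≤ B := le_trans (abs_nonneg _) (hB 1 one_pos)
  -- the weight is continuous and bounded by `1` on `(0,∞)`
  have hwc : Continuous fun t : ℝ => 1 - Real.exp (-(ε * t)) :=
    continuous_const.sub (Real.continuous_exp.comp (continuous_const.mul continuous_id).neg)
  have hw01 : ∀ t : ℝ, 0 < t → 0 ≤ 1 - Real.exp (-(ε * t)) ∧ 1 - Real.exp (-(ε * t)) ≤ ε * t :=
    fun t ht => one_sub_exp_neg_bounds (by positivity)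
  have hwi : IntegrableOn (fun t : ℝ => (1 - Real.exp (-(ε * t))) * f t) (Ioi 0) := by
    refine Integrable.bdd_mul hf hwc.aestronglyMeasurable (c := 1) ?_
    filter_upwards [ae_restrict_mem measurableSet_Ioi] with t ht
    obtain ⟨h0, h1⟩ := hw01 t ht
    have h2 : 1 - Real.exp (-(ε * t)) ≤ 1 := by linarith [Real.exp_pos (-(ε * t))]
    rw [Real.norm_eq_abs, abs_of_nonneg h0]
    exact h2
  -- split `(0,∞) = (0,τ] ∪ (τ,∞)`
  have hunion : Ioi (0:ℝ) = Ioc 0 τ ∪ Ioi τ := (Ioc_union_Ioi_eq_Ioi hτ.le).symm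
  have hI1 : IntegrableOn (fun t : ℝ => (1 - Real.exp (-(ε * t))) * f t) (Ioc 0 τ) :=
    hwi.mono_set Ioc_subset_Ioi_self
  have hI2 : IntegrableOn (fun t : ℝ => (1 - Real.exp (-(ε * t))) * f t) (Ioi τ) :=
    hwi.mono_set (Ioi_subset_Ioi hτ.le)
  rw [hunion, setIntegral_union Ioc_disjoint_Ioi_same measurableSet_Ioi hI1 hI2]
  -- early piece
  have h1 : (∫ t in Ioc 0 τ, (1 - Real.exp (-(ε * t))) * f t) ≤ ε * τ ^ 2 * B := by
    have hle := norm_setIntegral_le_of_norm_le_const (μ := volume) (s := Ioc (0:ℝ) τ)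
      (f := fun t : ℝ => (1 - Real.exp (-(ε * t))) * f t) (C := ε * τ * B) measure_Ioc_lt_top ?_
    · rw [Real.volume_real_Ioc_of_le hτ.le, sub_zero] at hle
      calc (∫ t in Ioc 0 τ, (1 - Real.exp (-(ε * t))) * f t)
          ≤ ‖∫ t in Ioc 0 τ, (1 - Real.exp (-(ε * t))) * f t‖ := Real.le_norm_self _
        _ ≤ ε * τ * B * τ := hle
        _ = ε * τ ^ 2 * B := by ring
    · intro t ht
      obtain ⟨h0, h1⟩ := hw01 t ht.1
      rw [norm_mul, Real.norm_eq_abs, Real.norm_eq_abs, abs_of_nonneg h0]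
      have ht2 : ε * t ≤ ε * τ := mul_le_mul_of_nonneg_left ht.2 hε.le
      calc (1 - Real.exp (-(ε * t))) * |f t| ≤ (ε * τ) * B :=
            mul_le_mul (h1.trans ht2) (hB t ht.1) (abs_nonneg _) (by positivity)
        _ = ε * τ * B := by ring
  -- late piece
  have h2 : (∫ t in Ioi τ, (1 - Real.exp (-(ε * t))) * f t) ≤ ∫ t in Ioi τ, max (f t) 0 := by
    refine setIntegral_mono_on hI2 ((hf.mono_set (Ioi_subset_Ioi hτ.le)).pos_part) measurableSet_Ioi ?_
    intro t ht
    have ht0 : 0 < t := hτ.trans ht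
    obtain ⟨h0, h1⟩ := hw01 t ht0
    have hw1 : 1 - Real.exp (-(ε * t)) ≤ 1 := by linarith [Real.exp_pos (-(ε * t))]
    rcases le_or_gt 0 (f t) with hft | hft
    · rw [max_eq_left hft]
      calc (1 - Real.exp (-(ε * t))) * f t ≤ 1 * f t := mul_le_mul_of_nonneg_right hw1 hft
        _ = f t := one_mul _
    · rw [max_eq_right hft.le]
      exact mul_nonpos_of_nonneg_of_nonpos h0 hft.le
  linarith

/-! ## The piece (as a def) and its stubs -/

/-- The piece `AnchorNoLateExcess` (verbatim the child statement of children.json / stub of Lines/regime_split.lean). -/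
def AnchorNoLateExcess : Prop :=
  ∀ (μ γ T : ℝ), 0 < μ → 0 < γ → 0 < T → ∀ η : ℝ, 0 < η → ∃ ε₀ : ℝ, 0 < ε₀ ∧ ∀ ε : ℝ, 0 < ε → ε < ε₀ → ∃ N₀ : ℕ, ∀ N : ℕ, N₀ ≤ N → (∫ t in Set.Ioi (0 : ℝ), (1 - Real.exp (-(ε * t))) * ∫ z, (∑ i : Fin N, (Literature.MathematicalPhysics.KineticTheory.HeatConduction.OscillatorChain.mk (fun q => μ * q ^ 4 / 4) (fun r => r ^ 4 / 4) γ).bondCurrent N i z) * (∫ y, (∑ i : Fin N, (Literature.MathematicalPhysics.KineticTheory.HeatConduction.OscillatorChain.mk (fun q => μ * q ^ 4 / 4) (fun r => r ^ 4 / 4) γ).bondCurrent N i y) ∂((Literature.MathematicalPhysics.KineticTheory.HeatConduction.OscillatorChain.mk (fun q => μ * q ^ 4 / 4) (fun r => r ^ 4 / 4) γ).transitionKernel N T T (t).toNNReal z)) ∂((Literature.MathematicalPhysics.KineticTheory.HeatConduction.OscillatorChain.mk (fun q => μ * q ^ 4 / 4) (fun r => r ^ 4 / 4) γ).gibbsMeasure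 N T)) ≤ η * N

/-- (I) at fixed `N` the equilibrium open-chain current autocorrelation of the anchor is integrable on `(0,∞)` (CEHR Thm 2.13 HOLDS for the anchor in tree: exponential convergence in the weighted norm). [folklore] -/
theorem stub_correlationIntegrable :
    ∀ (μ γ T : ℝ), 0 < μ → 0 < γ → 0 < T → ∀ N : ℕ, MeasureTheory.IntegrableOn (fun t : ℝ => ∫ z, (∑ i : Fin N, (Literature.MathematicalPhysics.KineticTheory.HeatConduction.OscillatorChain.mk (fun q => μ * q ^ 4 / 4) (fun r => r ^ 4 / 4) γ).bondCurrent N i z) * (∫ y, (∑ i : Fin N, (Literature.MathematicalPhysics.KineticTheory.HeatConduction.OscillatorChain.mk (fun q => μ * q ^ 4 / 4) (fun r => r ^ 4 / 4) γ).bondCurrent N i y) ∂((Literature.MathematicalPhysics.KineticTheory.HeatConduction.OscillatorChain.mk (fun q => μ * q ^ 4 / 4) (fun r => r ^ 4 / 4) γ).transitionKernel N T T (t).toNNReal z)) ∂((Literature.MathematicalPhysics.KineticTheory.HeatConduction.OscillatorChain.mk (fun q => μ * q ^ 4 / 4) (fun r => r ^ 4 / 4) γ).gibbsMeasure N T)) (Set.Ioi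 0) := by
  sorry

/-- (S) N-uniform static bound `|c_N(t)| ≤ A·N` (`|⟨J,P_tJ⟩| ≤ ‖J‖²_{L²(μ_{N,T})}` by `P_t`-invariance of the equal-temperature Gibbs state + Cauchy–Schwarz; `‖J‖² = Σ⟨j_i j_j⟩` has nearest-neighbour range, uniform sixth moments of the stretches). [folklore] -/
theorem stub_correlationStaticBound :
    ∀ (μ γ T : ℝ), 0 < μ → 0 < γ → 0 < T → ∃ A : ℝ, ∀ (N : ℕ) (t : ℝ), 0 < t → |∫ z, (∑ i : Fin N, (Literature.MathematicalPhysics.KineticTheory.HeatConduction.OscillatorChain.mk (fun q => μ * q ^ 4 / 4) (fun r => r ^ 4 / 4) γ).bondCurrent N i z) * (∫ y, (∑ i : Fin N, (Literature.MathematicalPhysics.KineticTheory.HeatConduction.OscillatorChain.mk (fun q => μ * q ^ 4 / 4) (fun r => r ^ 4 / 4) γ).bondCurrent N i y) ∂((Literature.MathematicalPhysics.KineticTheory.HeatConduction.OscillatorChain.mk (fun q => μ * q ^ 4 / 4) (fun r => r ^ 4 / 4) γ).transitionKernel N T T (t).toNNReal z)) ∂((Literature.MathematicalPhysics.KineticTheory.HeatConduction.OscillatorChain.mk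 (fun q => μ * q ^ 4 / 4) (fun r => r ^ 4 / 4) γ).gibbsMeasure N T)| ≤ A * N := by
  sorry

/-- (U⁺) the hard-cut late POSITIVE mass is uniformly small: `∀ η ∃ τ, N₀ ∀ N ≥ N₀, ∫_τ^∞ (c_N)₊ ≤ ηN` — the genuine content of the piece (no slow positive tail). [folklore] -/
theorem stub_uniformLatePositiveMass :
    ∀ (μ γ T : ℝ), 0 < μ → 0 < γ → 0 < T → ∀ η : ℝ, 0 < η → ∃ τ : ℝ, 0 < τ ∧ ∃ N₀ : ℕ, ∀ N : ℕ, N₀ ≤ N → (∫ t in Set.Ioi τ, max (∫ z, (∑ i : Fin N, (Literature.MathematicalPhysics.KineticTheory.HeatConduction.OscillatorChain.mk (fun q => μ * q ^ 4 / 4) (fun r => r ^ 4 / 4) γ).bondCurrent N i z) * (∫ y, (∑ i : Fin N, (Literature.MathematicalPhysics.KineticTheory.HeatConduction.OscillatorChain.mk (fun q => μ * q ^ 4 / 4) (fun r => r ^ 4 / 4) γ).bondCurrent N i y) ∂((Literature.MathematicalPhysics.KineticTheory.HeatConduction.OscillatorChain.mk (fun q => μ * q ^ 4 / 4) (fun r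 => r ^ 4 / 4) γ).transitionKernel N T T (t).toNNReal z)) ∂((Literature.MathematicalPhysics.KineticTheory.HeatConduction.OscillatorChain.mk (fun q => μ * q ^ 4 / 4) (fun r => r ^ 4 / 4) γ).gibbsMeasure N T)) 0) ≤ η * N := by
  sorry

/-- **The piece from its stubs**: choose `τ, N₀` from (U⁺) with `η/2`, `A` from (S), and `ε₀ = η/(2(Aτ²+1))`; then the soft-cut
bound gives `I_N(ε) ≤ ετ²A + ηN/2 ≤ ηN` for `N ≥ max N₀ 1`. [folklore] -/
theorem AnchorNoLateExcess_of
    (hI : ∀ (μ γ T : ℝ), 0 < μ → 0 < γ → 0 < T → ∀ N : ℕ, MeasureTheory.IntegrableOn (fun t : ℝ => ∫ z, (∑ i : Fin N, (Literature.MathematicalPhysics.KineticTheory.HeatConduction.OscillatorChain.mk (fun q => μ * q ^ 4 / 4) (fun r => r ^ 4 / 4) γ).bondCurrent N i z) * (∫ y, (∑ i : Fin N, (Literature.MathematicalPhysics.KineticTheory.HeatConduction.OscillatorChain.mk (fun q => μ * q ^ 4 / 4) (fun r => r ^ 4 / 4) γ).bondCurrent N i y) ∂((Literature.MathematicalPhysics.KineticTheory.HeatConduction.OscillatorChain.mk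 (fun q => μ * q ^ 4 / 4) (fun r => r ^ 4 / 4) γ).transitionKernel N T T (t).toNNReal z)) ∂((Literature.MathematicalPhysics.KineticTheory.HeatConduction.OscillatorChain.mk (fun q => μ * q ^ 4 / 4) (fun r => r ^ 4 / 4) γ).gibbsMeasure N T)) (Set.Ioi 0))
    (hS : ∀ (μ γ T : ℝ), 0 < μ → 0 < γ → 0 < T → ∃ A : ℝ, ∀ (N : ℕ) (t : ℝ), 0 < t → |∫ z, (∑ i : Fin N, (Literature.MathematicalPhysics.KineticTheory.HeatConduction.OscillatorChain.mk (fun q => μ * q ^ 4 / 4) (fun r => r ^ 4 / 4) γ).bondCurrent N i z) * (∫ y, (∑ i : Fin N, (Literature.MathematicalPhysics.KineticTheory.HeatConduction.OscillatorChain.mk (fun q => μ * q ^ 4 / 4) (fun r => r ^ 4 / 4) γ).bondCurrent N i y) ∂((Literature.MathematicalPhysics.KineticTheory.HeatConduction.OscillatorChain.mk (fun q => μ * q ^ 4 / 4) (fun r => r ^ 4 / 4) γ).transitionKernel N T T (t).toNNReal z)) ∂((Literature.MathematicalPhysics.KineticTheory.HeatConduction.OscillatorChain.mk (fun q => μ *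 q ^ 4 / 4) (fun r => r ^ 4 / 4) γ).gibbsMeasure N T)| ≤ A * N)
    (hU : ∀ (μ γ T : ℝ), 0 < μ → 0 < γ → 0 < T → ∀ η : ℝ, 0 < η → ∃ τ : ℝ, 0 < τ ∧ ∃ N₀ : ℕ, ∀ N : ℕ, N₀ ≤ N → (∫ t in Set.Ioi τ, max (∫ z, (∑ i : Fin N, (Literature.MathematicalPhysics.KineticTheory.HeatConduction.OscillatorChain.mk (fun q => μ * q ^ 4 / 4) (fun r => r ^ 4 / 4) γ).bondCurrent N i z) * (∫ y, (∑ i : Fin N, (Literature.MathematicalPhysics.KineticTheory.HeatConduction.OscillatorChain.mk (fun q => μ * q ^ 4 / 4) (fun r => r ^ 4 / 4) γ).bondCurrent N i y) ∂((Literature.MathematicalPhysics.KineticTheory.HeatConduction.OscillatorChain.mk (fun q => μ * q ^ 4 / 4) (fun r => r ^ 4 / 4) γ).transitionKernel N T T (t).toNNReal z)) ∂((Literature.MathematicalPhysics.KineticTheory.HeatConduction.OscillatorChain.mk (fun q => μ * q ^ 4 / 4) (fun r => r ^ 4 / 4) γ).gibbsMeasure N T)) 0) ≤ η * N) :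
    AnchorNoLateExcess := by
  intro μ γ T hμ hγ hT η hη
  obtain ⟨A, hA⟩ := hS μ γ T hμ hγ hT
  obtain ⟨τ, hτ, N₀, hN₀⟩ := hU μ γ T hμ hγ hT (η / 2) (by positivity)
  have hA0 : 0 ≤ A := by
    have h := hA 1 1 one_pos
    have : (0:ℝ) ≤ A * (1:ℕ) := le_trans (abs_nonneg _) h
    simpa using this
  refine ⟨η / (2 * (A * τ ^ 2 + 1)), by positivity, fun ε hε hεlt => ⟨max N₀ 1, fun N hN => ?_⟩⟩
  have hNN₀ : N₀ ≤ N := le_trans (le_max_left _ _) hN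
  have hN1 : (1:ℝ) ≤ N := by exact_mod_cast le_trans (le_max_right _ _) hN
  -- the generic bound with `B = A N`, `M = η N / 2`
  have hmain := softCut_integral_le
    (fun t : ℝ => ∫ z, (∑ i : Fin N, (Literature.MathematicalPhysics.KineticTheory.HeatConduction.OscillatorChain.mk (fun q => μ * q ^ 4 / 4) (fun r => r ^ 4 / 4) γ).bondCurrent N i z) * (∫ y, (∑ i : Fin N, (Literature.MathematicalPhysics.KineticTheory.HeatConduction.OscillatorChain.mk (fun q => μ * q ^ 4 / 4) (fun r => r ^ 4 / 4) γ).bondCurrent N i y) ∂((Literature.MathematicalPhysics.KineticTheory.HeatConduction.OscillatorChain.mk (fun q => μ * q ^ 4 / 4) (fun r => r ^ 4 / 4) γ).transitionKernel N T T (t).toNNReal z)) ∂((Literature.MathematicalPhysics.KineticTheory.HeatConduction.OscillatorChain.mk (fun q => μ * q ^ 4 / 4) (fun r => r ^ 4 / 4) γ).gibbsMeasure N T))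
    hε hτ (hI μ γ T hμ hγ hT N) (fun t ht => hA N t ht) (hN₀ N hNN₀)
  -- `ε τ² (A N) + η N / 2 ≤ η N`
  have hden : 0 < A * τ ^ 2 + 1 := by positivity
  have hε' : ε * (A * τ ^ 2 + 1) ≤ η / 2 := by
    have := (lt_div_iff₀ (by positivity : (0:ℝ) < 2 * (A * τ ^ 2 + 1))).1 hεlt
    nlinarith
  have hkey : ε * τ ^ 2 * (A * N) ≤ η / 2 * N := by
    have h1 : ε * τ ^ 2 * A ≤ ε * (A * τ ^ 2 + 1) := by nlinarith [hε.le, hA0, sq_nonneg τ]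
    have h2 : ε * τ ^ 2 * (A * N) = (ε * τ ^ 2 * A) * N := by ring
    rw [h2]
    exact mul_le_mul_of_nonneg_right (h1.trans hε') (by positivity)
  calc (∫ t in Set.Ioi (0:ℝ), (1 - Real.exp (-(ε * t))) * ∫ z, (∑ i : Fin N, (Literature.MathematicalPhysics.KineticTheory.HeatConduction.OscillatorChain.mk (fun q => μ * q ^ 4 / 4) (fun r => r ^ 4 / 4) γ).bondCurrent N i z) * (∫ y, (∑ i : Fin N, (Literature.MathematicalPhysics.KineticTheory.HeatConduction.OscillatorChain.mk (fun q => μ * q ^ 4 / 4) (fun r => r ^ 4 / 4) γ).bondCurrent N i y) ∂((Literature.MathematicalPhysics.KineticTheory.HeatConduction.OscillatorChain.mk (fun q => μ * q ^ 4 / 4) (fun r => r ^ 4 / 4) γ).transitionKernel N T T (t).toNNReal z)) ∂((Literature.MathematicalPhysics.KineticTheory.HeatConduction.OscillatorChain.mk (fun q => μ * q ^ 4 / 4) (fun r => r ^ 4 / 4) γ).gibbsMeasure N T))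
      ≤ ε * τ ^ 2 * (A * N) + η / 2 * N := hmain
    _ ≤ η / 2 * N + η / 2 * N := by linarith
    _ = η * N := by ring

end Summit.AtomisticToContinuum.FouriersLaw.Cruxes.AnchorKuboFourier.RegimeSplit.AnchorNoLateExcessBirth
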